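import Literature.MathematicalPhysics.QuantumFieldTheory.OSTimeTubeUniqueness
import Literature.Analysis.FunctionSpaces.SchwartzPolyKernel
import HarnessLib

/-!
# Slices of an OS time continuation: growth, continuity, holomorphy along temporal lines

`Literature.MathematicalPhysics.QuantumFieldTheory.OSTimeContinuation` records as the named fact
(A2) `OS1975_boundaryValue_of_timeContinuation` the statement of Osterwalder–Schrader II (1975),
§IV.2, p. 289 ("By standard arguments (see Vladimirov, p. 235 ff.) Theorem 4.3 implies …"): a
function `𝔚` continuous on the time tube, holomorphic in the times, translation invariant and of
OS growth has a tempered time-ray boundary value with half-space spectral support. This file is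
the first step of the proof of (A2): the elementary analysis of the **slices**
`x ↦ 𝔚(x + iy)` (`rayC x y I`), `y` in the temporal cone `T₊`.

* geometry: `mem_temporalCone_iff` (purely temporal, positive time gaps),
  `rayC_I_add_smul_cpxConfig` (`(x + iy) + κθ = (x + Re κ θ) + i(y + Im κ θ)`), the open set
  `{κ | y + Im κ θ ∈ T₊}` (`isOpen_setOf_gap_pos`);
* **growth** (from `HasOSGrowth`, OS II (4.6)): `norm_apply_rayC_I_le` (polynomial bound of the
  slice at `y ∈ T₊`), `exists_norm_apply_rayC_I_le_of_isCompact` (uniformly on compact subsets of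
  `T₊`), `norm_apply_rayC_I_add_smul_le` (along `y + sθ`, `s ≥ 0`, `θ` with non-negative gaps:
  growth `(1 + s)ᴺ`), `pow_mul_norm_apply_rayC_I_le` (the edge estimate
  `sᴺ ‖𝔚(x + i(tη + sY))‖ ≤ A (1 + ‖x‖)ᴺ`, Hörmander's (3.1.17) made explicit);
* **continuity**: `tendsto_apply_rayC_I` (in `y` within `T₊`);
* **holomorphy along complex temporal lines**: `differentiableOn_apply_add_smul_cpxConfig`
  (`κ ↦ 𝔚(z₀ + κθ)`), and for the smeared slices
  `differentiableOn_integral_rayC_I_add_smul` (`κ ↦ ∫ 𝔚((x + iy) + κθ) F(x) dx` is holomorphic on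
  `{y + Im κ θ ∈ T₊}`, dominated holomorphic parameter integrals,
  `Literature.Analysis.Complex.differentiableOn_integral_of_dominated`);
* the **Cauchy–Riemann identity for the smeared slices**
  `hasDerivAt_integral_rayC_I_add_smul`: `d/ds ∫ 𝔚(x + i(y + sθ)) F(x) dx = −i ∫ 𝔚(x + i(y + sθ)) (∂_θ F)(x) dx`
  (Hörmander's `I_k' = −i I_{k+1}`, here WITHOUT differentiating `𝔚` in the real directions:
  holomorphy in `κ` plus translation invariance of Lebesgue measure move the derivative onto `F`,
  `Literature.Analysis.FunctionSpaces.hasDerivAt_integral_mul_comp_sub_smul`);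
* `integral_rayC_I_mul_lineDerivOp_diag_eq_zero`: translation invariance of `𝔚` kills diagonal
  derivatives under the slice pairing.

## References

* K. Osterwalder, R. Schrader, *Axioms for Euclidean Green's functions II*, Comm. Math. Phys. 42
  (1975) 281–305, §IV.2, Thm. 4.3, (4.6)–(4.7). [OsterwalderSchraderCMP1975]
* L. Hörmander, *The Analysis of Linear Partial Differential Operators I*, Thm. 3.1.15,
  (3.1.13), (3.1.17). [HormanderALPDO1]
* V. S. Vladimirov, *Methods of the Theory of Functions of Many Complex Variables* (1966), §26.
  [Vladimirov1966]
-/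

noncomputable section

open MeasureTheory Filter Set Metric Complex
open scoped Topology SchwartzMap LineDeriv
open Literature.MathematicalPhysics.QuantumLattice Literature.Analysis.FunctionSpaces

namespace Literature.MathematicalPhysics.QuantumFieldTheory

variable {d n : ℕ}

/-! ### Geometry of the temporal cone and of temporal complex lines -/

/-- The temporal cone consists of the purely temporal configurations with positive time gaps. [folklore] -/
theorem mem_temporalCone_iff (y : Fin n → SpaceTime d) :
    y ∈ temporalCone d n ↔ (∀ (k : Fin n) (i : Fin d), y k i.succ = 0) ∧
      ∀ k : Fin n, 0 < succDiff (fun j => y j 0) k := by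
  constructor
  · rintro ⟨hc, hs⟩
    refine ⟨hs, fun k => ?_⟩
    have h1 : y = fun j => (y j 0) • e₀ d := by
      funext j; ext μ
      refine Fin.cases ?_ (fun i => ?_) μ
      · simp
      · simp [hs j i, Fin.succ_ne_zero]
    have h := hc k
    rw [h1, succDiff_map (fun t : ℝ => t • e₀ d) (fun a b => sub_smul a b _),
      smul_e₀_mem_forwardCone_iff] at h
    exact h
  · rintro ⟨hs, hg⟩
    refine ⟨fun k => ?_, hs⟩
    have h1 : y = fun j => (y j 0) • e₀ d := by
      funext j; ext μ
      refine Fin.cases ?_ (fun i => ?_) μ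
      · simp
      · simp [hs j i, Fin.succ_ne_zero]
    rw [h1, succDiff_map (fun t : ℝ => t • e₀ d) (fun a b => sub_smul a b _),
      smul_e₀_mem_forwardCone_iff]
    exact hg k

/-- Time gaps are additive: `succDiff (a + b) = succDiff a + succDiff b`. [folklore] -/
theorem succDiff_add' (a b : Fin n → ℝ) (k : Fin n) :
    succDiff (a + b) k = succDiff a k + succDiff b k := by
  cases n with
  | zero => exact k.elim0
  | succ m =>
    refine Fin.cases ?_ (fun j => ?_) k
    · simp [succDiff]
    · simp only [succDiff_succ, Pi.add_apply]; ring

/-- Time gaps are homogeneous: `succDiff (c • a) = c • succDiff a`. [folklore] -/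
theorem succDiff_smul' (c : ℝ) (a : Fin n → ℝ) (k : Fin n) :
    succDiff (c • a) k = c * succDiff a k := by
  cases n with
  | zero => exact k.elim0
  | succ m =>
    refine Fin.cases ?_ (fun j => ?_) k
    · simp [succDiff]
    · simp only [succDiff_succ, Pi.smul_apply, smul_eq_mul]; ring

/-- The time gaps of `y + s θ`. [folklore] -/
theorem succDiff_time_add_smul (y θ : Fin n → SpaceTime d) (s : ℝ) (k : Fin n) :
    succDiff (fun j => (y + s • θ) j 0) k =
      succDiff (fun j => y j 0) k + s * succDiff (fun j => θ j 0) k := by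
  have h : (fun j => (y + s • θ) j 0) = (fun j => y j 0) + s • (fun j => θ j 0) := by
    funext j; simp
  rw [h, succDiff_add', succDiff_smul']

/-- `y + s θ` is purely temporal when `y` and `θ` are. [folklore] -/
theorem add_smul_apply_succ_eq_zero {y θ : Fin n → SpaceTime d}
    (hy : ∀ (k : Fin n) (i : Fin d), y k i.succ = 0) (hθ : ∀ (k : Fin n) (i : Fin d), θ k i.succ = 0)
    (s : ℝ) (k : Fin n) (i : Fin d) : (y + s • θ) k i.succ = 0 := by
  simp [hy k i, hθ k i]

/-- **Stability of the temporal cone along directions with non-negative gaps**: for `y ∈ T₊`,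
`θ` purely temporal with `succDiff θ⁰ ≥ 0` and `s ≥ 0`, `y + s θ ∈ T₊` with gaps at least those of
`y`. [folklore] -/
theorem add_smul_mem_temporalCone {y θ : Fin n → SpaceTime d} (hy : y ∈ temporalCone d n)
    (hθ : ∀ (k : Fin n) (i : Fin d), θ k i.succ = 0) (hθg : ∀ k, 0 ≤ succDiff (fun j => θ j 0) k)
    {s : ℝ} (hs : 0 ≤ s) : y + s • θ ∈ temporalCone d n := by
  rw [mem_temporalCone_iff] at hy ⊢
  refine ⟨add_smul_apply_succ_eq_zero hy.1 hθ s, fun k => ?_⟩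
  rw [succDiff_time_add_smul]
  exact lt_add_of_pos_of_le (hy.2 k) (mul_nonneg hs (hθg k))

/-- The temporal cone is a cone. [folklore] -/
theorem smul_mem_temporalCone {η : Fin n → SpaceTime d} (hη : η ∈ temporalCone d n) {t : ℝ}
    (ht : 0 < t) : t • η ∈ temporalCone d n := by
  have hη' := (mem_temporalCone_iff η).1 hη
  rw [mem_temporalCone_iff]
  refine ⟨fun k i => by simp [hη'.1 k i], fun k => ?_⟩
  have h : (fun j => (t • η) j 0) = t • (fun j => η j 0) := by funext j; simp
  rw [h, succDiff_smul']
  exact mul_pos ht (hη'.2 k)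

/-- The temporal cone is stable under addition (gaps add). [folklore] -/
theorem add_mem_temporalCone {y y' : Fin n → SpaceTime d} (hy : y ∈ temporalCone d n)
    (hy' : y' ∈ temporalCone d n) : y + y' ∈ temporalCone d n := by
  have h1 := (mem_temporalCone_iff y).1 hy
  have h2 := (mem_temporalCone_iff y').1 hy'
  rw [mem_temporalCone_iff]
  refine ⟨fun k i => by simp [h1.1 k i, h2.1 k i], fun k => ?_⟩
  have h : (fun j => (y + y') j 0) = (fun j => y j 0) + (fun j => y' j 0) := by funext j; simp
  rw [h, succDiff_add']
  exact add_pos (h1.2 k) (h2.2 k)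

/-- Moving along a complex temporal line: `(x + iy) + κ θ = (x + Re κ θ) + i (y + Im κ θ)`. [folklore] -/
theorem rayC_I_add_smul_cpxConfig (x y θ : Fin n → SpaceTime d) (κ : ℂ) :
    rayC x y I + κ • cpxConfig θ = rayC (x + κ.re • θ) (y + κ.im • θ) I := by
  funext k μ
  apply Complex.ext <;> simp [rayC_apply]

/-- The imaginary parts of the time differences along `x + iy`: the gaps of `y`. [folklore] -/
theorem im_succDiff_rayC_I (x y : Fin n → SpaceTime d) (k : Fin n) :
    (succDiff (fun j => rayC x y I j 0) k).im = succDiff (fun j => y j 0) k := by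
  rw [← succDiff_map Complex.im (fun a b => Complex.sub_im a b)]
  congr 1
  funext j
  simp [rayC_apply]

/-- **The set of admissible heights along a temporal line is open**: for real data
`g, c : Fin n → ℝ`, `{v | ∀ k, 0 < g k + v c k}` is open. [folklore] -/
theorem isOpen_setOf_gap_pos (g c : Fin n → ℝ) : IsOpen {v : ℝ | ∀ k, 0 < g k + v * c k} := by
  simp only [setOf_forall]
  exact isOpen_iInter_of_finite fun k =>
    isOpen_lt continuous_const (continuous_const.add (continuous_id.mul continuous_const))

/-- The same set is convex (an intersection of half-lines). [folklore] -/
theorem convex_setOf_gap_pos (g c : Fin n → ℝ) : Convex ℝ {v : ℝ | ∀ k, 0 < g k + v * c k} := by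
  simp only [setOf_forall]
  refine convex_iInter fun k => ?_
  have hlin : IsLinearMap ℝ fun v : ℝ => v * c k :=
    ⟨fun u v => add_mul u v _, fun a v => mul_assoc a v _⟩
  have h := convex_halfSpace_gt hlin (-g k)
  have hset : {v : ℝ | 0 < g k + v * c k} = {w : ℝ | -g k < w * c k} := by
    ext v
    constructor <;> intro hv
    · have hv' : 0 < g k + v * c k := hv
      show -g k < v * c k
      linarith
    · have hv' : -g k < v * c k := hv
      show 0 < g k + v * c k
      linarith
  rw [hset]
  exact h

/-- The complex parameters `κ` for which `y + Im κ θ` keeps positive gaps form an open set. [folklore] -/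
theorem isOpen_setOf_im_gap_pos (g c : Fin n → ℝ) :
    IsOpen {κ : ℂ | ∀ k, 0 < g k + κ.im * c k} :=
  (isOpen_setOf_gap_pos g c).preimage continuous_im

/-- … and a convex (hence preconnected) set. [folklore] -/
theorem convex_setOf_im_gap_pos (g c : Fin n → ℝ) :
    Convex ℝ {κ : ℂ | ∀ k, 0 < g k + κ.im * c k} :=
  (convex_setOf_gap_pos g c).linear_preimage Complex.imLm

/-! ### Norms of slice points -/

/-- `‖cpxConfig x‖ ≤ ‖x‖` (sup norms outside, Euclidean norm on each `x_k`). [folklore] -/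
theorem norm_cpxConfig_le (x : Fin n → SpaceTime d) : ‖cpxConfig x‖ ≤ ‖x‖ := by
  refine (pi_norm_le_iff_of_nonneg (norm_nonneg x)).2 fun k => ?_
  refine (pi_norm_le_iff_of_nonneg (norm_nonneg x)).2 fun μ => ?_
  rw [cpxConfig_apply, complexifyPoint_apply, Complex.norm_real]
  exact (PiLp.norm_apply_le (x k) μ).trans (norm_le_pi_norm x k)

/-- `‖x + iy‖ ≤ ‖x‖ + ‖y‖`. [folklore] -/
theorem norm_rayC_I_le (x y : Fin n → SpaceTime d) : ‖rayC x y I‖ ≤ ‖x‖ + ‖y‖ := by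
  rw [rayC]
  refine (norm_add_le _ _).trans (add_le_add (norm_cpxConfig_le x) ?_)
  rw [norm_smul, Complex.norm_I, one_mul]
  exact norm_cpxConfig_le y

/-- `1 + ‖x + iy‖ ≤ (1 + ‖x‖)(1 + ‖y‖)`. [folklore] -/
theorem one_add_norm_rayC_I_le (x y : Fin n → SpaceTime d) :
    1 + ‖rayC x y I‖ ≤ (1 + ‖x‖) * (1 + ‖y‖) := by
  have h := norm_rayC_I_le x y
  nlinarith [norm_nonneg x, norm_nonneg y]

/-! ### Growth of the slices -/

section Growth

variable {𝔚 : (Fin n → Fin (d + 1) → ℂ) → ℂ} {C : ℝ} {N : ℕ}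
  (hG : ∀ z ∈ timeTube d n, ‖𝔚 z‖ ≤ C * (1 + ‖z‖) ^ N *
    (1 + ∑ k, ((succDiff (fun j => z j 0) k).im)⁻¹) ^ N)
include hG

/-- The constant of an OS growth bound is non-negative (the time tube is not empty). [folklore] -/
theorem nonneg_of_osGrowth : 0 ≤ C := by
  set y : Fin n → SpaceTime d := fun k => (((k : ℕ) : ℝ) + 1) • e₀ d with hy
  have hyT : y ∈ temporalCone d n := stdDirection_mem_temporalCone
  have hz : rayC 0 y I ∈ timeTube d n := rayC_mem_timeTube 0 hyT (by simp)
  have h := (norm_nonneg _).trans (hG _ hz)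
  have hpos : 0 < (1 + ‖rayC 0 y I‖) ^ N *
      (1 + ∑ k, ((succDiff (fun j => rayC 0 y I j 0) k).im)⁻¹) ^ N := by
    refine mul_pos (by positivity) (pow_pos ?_ _)
    refine add_pos_of_pos_of_nonneg one_pos (Finset.sum_nonneg fun k _ => ?_)
    rw [im_succDiff_rayC_I]
    exact (inv_pos.2 (((mem_temporalCone_iff y).1 hyT).2 k)).le
  rw [mul_assoc] at h
  by_contra hC
  exact (not_le.2 (mul_neg_of_neg_of_pos (not_le.1 hC) hpos)) h

/-- **Polynomial growth of the slice at a point of the temporal cone**: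
`‖𝔚(x + iy)‖ ≤ C (1 + ‖y‖)ᴺ (1 + ∑ₖ (gapₖ y)⁻¹)ᴺ (1 + ‖x‖)ᴺ`. [cite: OsterwalderSchraderCMP1975, §IV.2 eq. (4.6)] -/
theorem norm_apply_rayC_I_le {y : Fin n → SpaceTime d} (hy : y ∈ temporalCone d n)
    (x : Fin n → SpaceTime d) :
    ‖𝔚 (rayC x y I)‖ ≤ C * ((1 + ‖y‖) ^ N * (1 + ∑ k, (succDiff (fun j => y j 0) k)⁻¹) ^ N) *
      (1 + ‖x‖) ^ N := by
  have hC := nonneg_of_osGrowth hG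
  have h := hG _ (rayC_mem_timeTube x hy (by simp : 0 < I.im))
  simp only [im_succDiff_rayC_I] at h
  have hgap : 0 ≤ 1 + ∑ k, (succDiff (fun j => y j 0) k)⁻¹ :=
    add_nonneg zero_le_one (Finset.sum_nonneg fun k _ =>
      (inv_pos.2 (((mem_temporalCone_iff y).1 hy).2 k)).le)
  calc ‖𝔚 (rayC x y I)‖
      ≤ C * (1 + ‖rayC x y I‖) ^ N * (1 + ∑ k, (succDiff (fun j => y j 0) k)⁻¹) ^ N := h
    _ ≤ C * ((1 + ‖x‖) * (1 + ‖y‖)) ^ N * (1 + ∑ k, (succDiff (fun j => y j 0) k)⁻¹) ^ N := by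
        gcongr
        exact one_add_norm_rayC_I_le x y
    _ = C * ((1 + ‖y‖) ^ N * (1 + ∑ k, (succDiff (fun j => y j 0) k)⁻¹) ^ N) * (1 + ‖x‖) ^ N := by
        rw [mul_pow]; ring

/-- **Uniform polynomial growth of the slices over a compact set of heights** `K ⊆ T₊`:
`‖𝔚(x + iy)‖ ≤ A (1 + ‖x‖)ᴺ` for all `y ∈ K` (the gap factor is continuous on `T₊`). [folklore] -/
theorem exists_norm_apply_rayC_I_le_of_isCompact {K : Set (Fin n → SpaceTime d)} (hK : IsCompact K)
    (hKT : K ⊆ temporalCone d n) :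
    ∃ A : ℝ, 0 ≤ A ∧ ∀ y ∈ K, ∀ x, ‖𝔚 (rayC x y I)‖ ≤ A * (1 + ‖x‖) ^ N := by
  have hC := nonneg_of_osGrowth hG
  set φ : (Fin n → SpaceTime d) → ℝ := fun y =>
    (1 + ‖y‖) ^ N * (1 + ∑ k, (succDiff (fun j => y j 0) k)⁻¹) ^ N with hφ
  have hlin : ∀ k : Fin n, Continuous fun y : Fin n → SpaceTime d => succDiff (fun j => y j 0) k := by
    intro k
    have hc : Continuous fun y : Fin n → SpaceTime d => fun j => y j 0 :=
      continuous_pi fun j => (EuclideanSpace.proj (0 : Fin (d + 1))).continuous.comp (continuous_apply j)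
    cases n with
    | zero => exact k.elim0
    | succ m =>
      refine Fin.cases ?_ (fun i => ?_) k
      · simp only [succDiff_zero]
        exact (EuclideanSpace.proj (0 : Fin (d + 1))).continuous.comp (continuous_apply _)
      · simp only [succDiff_succ]
        exact ((EuclideanSpace.proj (0 : Fin (d + 1))).continuous.comp (continuous_apply _)).sub
          ((EuclideanSpace.proj (0 : Fin (d + 1))).continuous.comp (continuous_apply _))
  have hφc : ContinuousOn φ (temporalCone d n) := by
    refine ((continuous_const.add continuous_norm).pow N).continuousOn.mul ?_
    refine (continuousOn_const.add (continuousOn_finsetSum _ fun k _ => ?_)).pow N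
    refine ((hlin k).continuousOn).inv₀ fun y hy => ?_
    exact (((mem_temporalCone_iff y).1 hy).2 k).ne'
  obtain ⟨B, hB⟩ := hK.exists_bound_of_continuousOn (hφc.mono hKT)
  refine ⟨C * max B 0, by positivity, fun y hy x => ?_⟩
  have h := norm_apply_rayC_I_le hG (hKT hy) x
  have hφy : φ y ≤ max B 0 := by
    have h1 := hB y hy
    rw [Real.norm_eq_abs] at h1
    exact (le_abs_self _).trans (h1.trans (le_max_left _ _))
  calc ‖𝔚 (rayC x y I)‖ ≤ C * φ y * (1 + ‖x‖) ^ N := h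
    _ ≤ C * max B 0 * (1 + ‖x‖) ^ N := by gcongr

/-- **Growth along a temporal direction with non-negative gaps**: for `y ∈ T₊`, `θ` purely temporal
with `succDiff θ⁰ ≥ 0`, and `s ≥ 0`,
`‖𝔚(x + i(y + sθ))‖ ≤ C (1 + ‖y‖)ᴺ (1 + ∑ (gapₖ y)⁻¹)ᴺ (1 + ‖θ‖)ᴺ (1 + s)ᴺ (1 + ‖x‖)ᴺ` — polynomial
growth in `s` (the gaps only increase along `θ`). [folklore] -/
theorem norm_apply_rayC_I_add_smul_le {y θ : Fin n → SpaceTime d} (hy : y ∈ temporalCone d n)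
    (hθ : ∀ (k : Fin n) (i : Fin d), θ k i.succ = 0) (hθg : ∀ k, 0 ≤ succDiff (fun j => θ j 0) k)
    {s : ℝ} (hs : 0 ≤ s) (x : Fin n → SpaceTime d) :
    ‖𝔚 (rayC x (y + s • θ) I)‖ ≤
      C * ((1 + ‖y‖) ^ N * (1 + ∑ k, (succDiff (fun j => y j 0) k)⁻¹) ^ N * (1 + ‖θ‖) ^ N) *
        (1 + s) ^ N * (1 + ‖x‖) ^ N := by
  have hC := nonneg_of_osGrowth hG
  have hys := add_smul_mem_temporalCone hy hθ hθg hs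
  have h := norm_apply_rayC_I_le hG hys x
  have hy' := (mem_temporalCone_iff y).1 hy
  -- the gap factor decreases
  have hgap : 1 + ∑ k, (succDiff (fun j => (y + s • θ) j 0) k)⁻¹ ≤
      1 + ∑ k, (succDiff (fun j => y j 0) k)⁻¹ := by
    have hsum : ∑ k, (succDiff (fun j => (y + s • θ) j 0) k)⁻¹ ≤
        ∑ k, (succDiff (fun j => y j 0) k)⁻¹ :=
      Finset.sum_le_sum fun k _ => by
        rw [succDiff_time_add_smul]
        exact inv_anti₀ (hy'.2 k) (le_add_of_nonneg_right (mul_nonneg hs (hθg k)))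
    linarith
  have hgap0 : 0 ≤ 1 + ∑ k, (succDiff (fun j => (y + s • θ) j 0) k)⁻¹ :=
    add_nonneg zero_le_one (Finset.sum_nonneg fun k _ =>
      (inv_pos.2 (((mem_temporalCone_iff _).1 hys).2 k)).le)
  -- the norm grows linearly
  have hnorm : 1 + ‖y + s • θ‖ ≤ (1 + ‖y‖) * (1 + ‖θ‖) * (1 + s) := by
    have h1 : ‖y + s • θ‖ ≤ ‖y‖ + s * ‖θ‖ := by
      have h2 : ‖s • θ‖ = s * ‖θ‖ := by rw [norm_smul, Real.norm_eq_abs, abs_of_nonneg hs]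
      rw [← h2]
      exact norm_add_le _ _
    nlinarith [norm_nonneg y, norm_nonneg θ, mul_nonneg hs (norm_nonneg θ),
      mul_nonneg (norm_nonneg y) (norm_nonneg θ), mul_nonneg (mul_nonneg hs (norm_nonneg θ)) (norm_nonneg y)]
  calc ‖𝔚 (rayC x (y + s • θ) I)‖
      ≤ C * ((1 + ‖y + s • θ‖) ^ N * (1 + ∑ k, (succDiff (fun j => (y + s • θ) j 0) k)⁻¹) ^ N) *
          (1 + ‖x‖) ^ N := h
    _ ≤ C * (((1 + ‖y‖) * (1 + ‖θ‖) * (1 + s)) ^ N * (1 + ∑ k, (succDiff (fun j => y j 0) k)⁻¹) ^ N) *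
          (1 + ‖x‖) ^ N := by gcongr
    _ = C * ((1 + ‖y‖) ^ N * (1 + ∑ k, (succDiff (fun j => y j 0) k)⁻¹) ^ N * (1 + ‖θ‖) ^ N) *
        (1 + s) ^ N * (1 + ‖x‖) ^ N := by rw [mul_pow, mul_pow]; ring

omit hG in
/-- `t η + s Y ∈ T₊` for `η, Y ∈ T₊`, `t ≥ 0`, `s > 0`. [folklore] -/
theorem smul_add_smul_mem_temporalCone {η Y : Fin n → SpaceTime d} (hη : η ∈ temporalCone d n)
    (hY : Y ∈ temporalCone d n) {t s : ℝ} (ht : 0 ≤ t) (hs : 0 < s) :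
    t • η + s • Y ∈ temporalCone d n := by
  have hη' := (mem_temporalCone_iff η).1 hη
  have hY' := (mem_temporalCone_iff Y).1 hY
  rw [mem_temporalCone_iff]
  refine ⟨fun k i => by simp [hη'.1 k i, hY'.1 k i], fun k => ?_⟩
  have h : (fun j => (t • η + s • Y) j 0) = t • (fun j => η j 0) + s • (fun j => Y j 0) := by
    funext j; simp
  rw [h, succDiff_add', succDiff_smul', succDiff_smul']
  exact add_pos_of_nonneg_of_pos (mul_nonneg ht (hη'.2 k).le) (mul_pos hs (hY'.2 k))

omit hG in
/-- **The edge estimate** (Hörmander's (3.1.17) in explicit form): for `η, Y ∈ T₊`, `0 ≤ t`,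
`0 < s ≤ 1`, `sᴺ (1 + ∑ₖ (gapₖ(tη + sY))⁻¹)ᴺ ≤ (1 + ∑ₖ (gapₖ Y)⁻¹)ᴺ` — the inverse powers of the
gaps are compensated by `sᴺ`. [cite: HormanderALPDO1, Thm 3.1.15 eq. (3.1.17)] -/
theorem pow_mul_gapFactor_pow_le {η Y : Fin n → SpaceTime d} (hη : η ∈ temporalCone d n)
    (hY : Y ∈ temporalCone d n) {t s : ℝ} (ht : 0 ≤ t) (hs : 0 < s) (hs1 : s ≤ 1) (N : ℕ) :
    s ^ N * (1 + ∑ k, (succDiff (fun j => (t • η + s • Y) j 0) k)⁻¹) ^ N ≤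
      (1 + ∑ k, (succDiff (fun j => Y j 0) k)⁻¹) ^ N := by
  have hη' := (mem_temporalCone_iff η).1 hη
  have hY' := (mem_temporalCone_iff Y).1 hY
  rw [← mul_pow]
  refine pow_le_pow_left₀ (mul_nonneg hs.le (add_nonneg zero_le_one (Finset.sum_nonneg
    fun k _ => (inv_pos.2 (((mem_temporalCone_iff _).1
      (smul_add_smul_mem_temporalCone hη hY ht hs)).2 k)).le))) ?_ N
  have h : (fun j => (t • η + s • Y) j 0) = t • (fun j => η j 0) + s • (fun j => Y j 0) := by
    funext j; simp
  rw [h, mul_add, mul_one, Finset.mul_sum]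
  refine add_le_add hs1 (Finset.sum_le_sum fun k _ => ?_)
  rw [succDiff_add', succDiff_smul', succDiff_smul']
  have hYk := hY'.2 k
  have hle : s * succDiff (fun j => Y j 0) k ≤ t * succDiff (fun j => η j 0) k + s * succDiff (fun j => Y j 0) k :=
    le_add_of_nonneg_left (mul_nonneg ht (hη'.2 k).le)
  calc s * (t * succDiff (fun j => η j 0) k + s * succDiff (fun j => Y j 0) k)⁻¹
      ≤ s * (s * succDiff (fun j => Y j 0) k)⁻¹ :=
        mul_le_mul_of_nonneg_left (inv_anti₀ (mul_pos hs hYk) hle) hs.le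
    _ = (succDiff (fun j => Y j 0) k)⁻¹ := by
        field_simp

/-- **Growth at the edge along the reference direction**: for `η, Y ∈ T₊` there is `A ≥ 0` with
`sᴺ ‖𝔚(x + i(tη + sY))‖ ≤ A (1 + ‖x‖)ᴺ` for all `0 ≤ t ≤ 1`, `0 < s ≤ 1` and all `x` (this is what
makes the remainder of Hörmander's formula (3.1.19) dominated as `t → 0⁺`). [cite: HormanderALPDO1, Thm 3.1.15 proof] -/
theorem pow_mul_norm_apply_rayC_I_le {η Y : Fin n → SpaceTime d} (hη : η ∈ temporalCone d n)
    (hY : Y ∈ temporalCone d n) :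
    ∃ A : ℝ, 0 ≤ A ∧ ∀ t : ℝ, 0 ≤ t → t ≤ 1 → ∀ s : ℝ, 0 < s → s ≤ 1 → ∀ x,
      s ^ N * ‖𝔚 (rayC x (t • η + s • Y) I)‖ ≤ A * (1 + ‖x‖) ^ N := by
  have hC := nonneg_of_osGrowth hG
  have hgapY : 0 ≤ 1 + ∑ k, (succDiff (fun j => Y j 0) k)⁻¹ :=
    add_nonneg zero_le_one (Finset.sum_nonneg fun k _ =>
      (inv_pos.2 (((mem_temporalCone_iff Y).1 hY).2 k)).le)
  refine ⟨C * ((1 + (‖η‖ + ‖Y‖)) ^ N * (1 + ∑ k, (succDiff (fun j => Y j 0) k)⁻¹) ^ N),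
    mul_nonneg hC (mul_nonneg (by positivity) (pow_nonneg hgapY N)), fun t ht ht1 s hs hs1 x => ?_⟩
  have hmem := smul_add_smul_mem_temporalCone hη hY ht hs
  have h := norm_apply_rayC_I_le hG hmem x
  have hedge := pow_mul_gapFactor_pow_le hη hY ht hs hs1 N
  have hnorm : ‖t • η + s • Y‖ ≤ ‖η‖ + ‖Y‖ := by
    refine (norm_add_le _ _).trans (add_le_add ?_ ?_)
    · rw [norm_smul, Real.norm_eq_abs, abs_of_nonneg ht]
      exact mul_le_of_le_one_left (norm_nonneg _) ht1
    · rw [norm_smul, Real.norm_eq_abs, abs_of_pos hs]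
      exact mul_le_of_le_one_left (norm_nonneg _) hs1
  have hgap0 : 0 ≤ (1 + ∑ k, (succDiff (fun j => (t • η + s • Y) j 0) k)⁻¹) ^ N :=
    pow_nonneg (add_nonneg zero_le_one (Finset.sum_nonneg fun k _ =>
      (inv_pos.2 (((mem_temporalCone_iff _).1 hmem).2 k)).le)) N
  calc s ^ N * ‖𝔚 (rayC x (t • η + s • Y) I)‖
      ≤ s ^ N * (C * ((1 + ‖t • η + s • Y‖) ^ N *
          (1 + ∑ k, (succDiff (fun j => (t • η + s • Y) j 0) k)⁻¹) ^ N) * (1 + ‖x‖) ^ N) := by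
        gcongr
    _ = C * (1 + ‖t • η + s • Y‖) ^ N *
          (s ^ N * (1 + ∑ k, (succDiff (fun j => (t • η + s • Y) j 0) k)⁻¹) ^ N) * (1 + ‖x‖) ^ N := by
        ring
    _ ≤ C * (1 + (‖η‖ + ‖Y‖)) ^ N * (1 + ∑ k, (succDiff (fun j => Y j 0) k)⁻¹) ^ N * (1 + ‖x‖) ^ N := by
        gcongr
    _ = C * ((1 + (‖η‖ + ‖Y‖)) ^ N * (1 + ∑ k, (succDiff (fun j => Y j 0) k)⁻¹) ^ N) *
        (1 + ‖x‖) ^ N := by ring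

end Growth

/-! ### Continuity of the slices in the height -/

/-- **Continuity of the slices in the height within the temporal cone**: if `y i → y₀` with
`y i, y₀ ∈ T₊`, then `𝔚(x + i yᵢ) → 𝔚(x + i y₀)` (`𝔚` is continuous on the time tube). [folklore] -/
theorem tendsto_apply_rayC_I {𝔚 : (Fin n → Fin (d + 1) → ℂ) → ℂ} (hGc : ContinuousOn 𝔚 (timeTube d n))
    {ι : Type*} {l : Filter ι} {y : ι → Fin n → SpaceTime d} {y₀ : Fin n → SpaceTime d}
    (hy : ∀ᶠ i in l, y i ∈ temporalCone d n) (hy₀ : y₀ ∈ temporalCone d n)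
    (hlim : Tendsto y l (𝓝 y₀)) (x : Fin n → SpaceTime d) :
    Tendsto (fun i => 𝔚 (rayC x (y i) I)) l (𝓝 (𝔚 (rayC x y₀ I))) := by
  have hz₀ : rayC x y₀ I ∈ timeTube d n := rayC_mem_timeTube x hy₀ (by simp)
  have hcw : ContinuousWithinAt 𝔚 (timeTube d n) (rayC x y₀ I) := hGc _ hz₀
  have hray : Tendsto (fun i => rayC x (y i) I) l (𝓝[timeTube d n] (rayC x y₀ I)) := by
    refine tendsto_nhdsWithin_iff.2 ⟨?_, ?_⟩
    · have hc : Continuous fun y' : Fin n → SpaceTime d => rayC x y' I := by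
        unfold rayC
        exact continuous_const.add (continuous_cpxConfig.const_smul I)
      exact (hc.tendsto y₀).comp hlim
    · filter_upwards [hy] with i hi using rayC_mem_timeTube x hi (by simp)
  exact hcw.tendsto.comp hray

/-! ### Holomorphy along complex temporal lines -/

/-- Along a purely temporal direction `θ`, adding `κ θ` only changes the times:
`z₀ + κ θ = withTimes z₀ (z₀⁰ + κ θ⁰)`. [folklore] -/
theorem add_smul_cpxConfig_eq_withTimes (z₀ : Fin n → Fin (d + 1) → ℂ) {θ : Fin n → SpaceTime d}
    (hθ : ∀ (k : Fin n) (i : Fin d), θ k i.succ = 0) (κ : ℂ) :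
    z₀ + κ • cpxConfig θ = withTimes z₀ (fun k => z₀ k 0 + κ * (θ k 0 : ℂ)) := by
  funext k μ
  by_cases hμ : μ = 0
  · subst hμ
    simp [cpxConfig_apply]
  · obtain ⟨i, rfl⟩ := Fin.exists_succ_eq.2 hμ
    simp [cpxConfig_apply, hθ k i]

/-- **Holomorphy along complex temporal lines**: for `𝔚` holomorphic in the times on the time tube,
`z₀` in the time tube and `θ` purely temporal, `κ ↦ 𝔚(z₀ + κθ)` is holomorphic where `z₀ + κθ`
stays in the time tube. [folklore] -/
theorem differentiableOn_apply_add_smul_cpxConfig {𝔚 : (Fin n → Fin (d + 1) → ℂ) → ℂ}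
    (hGh : IsTimeHolomorphicOn 𝔚 (timeTube d n)) {z₀ : Fin n → Fin (d + 1) → ℂ}
    (hz₀ : z₀ ∈ timeTube d n) {θ : Fin n → SpaceTime d} (hθ : ∀ (k : Fin n) (i : Fin d), θ k i.succ = 0) :
    DifferentiableOn ℂ (fun κ : ℂ => 𝔚 (z₀ + κ • cpxConfig θ))
      {κ | z₀ + κ • cpxConfig θ ∈ timeTube d n} := by
  have haff : Differentiable ℂ fun κ : ℂ => fun k : Fin n => z₀ k 0 + κ * (θ k 0 : ℂ) :=
    differentiable_pi.2 fun k => (differentiable_const _).add (differentiable_id.mul_const _)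
  have h := (hGh _ hz₀).comp haff.differentiableOn (fun κ (hκ : z₀ + κ • cpxConfig θ ∈ timeTube d n) => by
    show withTimes z₀ (fun k => z₀ k 0 + κ * (θ k 0 : ℂ)) ∈ timeTube d n
    rwa [← add_smul_cpxConfig_eq_withTimes z₀ hθ κ])
  refine h.congr fun κ _ => ?_
  simp only [Function.comp_apply, ← add_smul_cpxConfig_eq_withTimes z₀ hθ κ]

/-- Membership of `(x + iy) + κθ` in the time tube is decided by the gaps of `y + Im κ θ`. [folklore] -/
theorem rayC_I_add_smul_mem_timeTube {x y θ : Fin n → SpaceTime d}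
    (hy : ∀ (k : Fin n) (i : Fin d), y k i.succ = 0) (hθ : ∀ (k : Fin n) (i : Fin d), θ k i.succ = 0)
    {κ : ℂ} (hκ : ∀ k, 0 < succDiff (fun j => y j 0) k + κ.im * succDiff (fun j => θ j 0) k) :
    rayC x y I + κ • cpxConfig θ ∈ timeTube d n := by
  rw [rayC_I_add_smul_cpxConfig]
  refine rayC_mem_timeTube _ ?_ (by simp)
  rw [mem_temporalCone_iff]
  refine ⟨add_smul_apply_succ_eq_zero hy hθ _, fun k => ?_⟩
  rw [succDiff_time_add_smul]
  exact hκ k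

section Smeared

variable {𝔚 : (Fin n → Fin (d + 1) → ℂ) → ℂ} {C : ℝ} {N : ℕ}
  (hGc : ContinuousOn 𝔚 (timeTube d n)) (hGh : IsTimeHolomorphicOn 𝔚 (timeTube d n))
  (hG : ∀ z ∈ timeTube d n, ‖𝔚 z‖ ≤ C * (1 + ‖z‖) ^ N *
    (1 + ∑ k, ((succDiff (fun j => z j 0) k).im)⁻¹) ^ N)

include hGc in
/-- The slice `x ↦ 𝔚(x + iy)`, `y ∈ T₊`, is continuous. [folklore] -/
theorem continuous_apply_rayC_I {y : Fin n → SpaceTime d} (hy : y ∈ temporalCone d n) :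
    Continuous fun x : Fin n → SpaceTime d => 𝔚 (rayC x y I) :=
  continuous_comp_rayC_of_continuousOn_timeTube hGc hy (by simp)

include hGc hG in
/-- The slice pairing `∫ 𝔚(x + iy) F(x) dx`, `y ∈ T₊`, is an honest Lebesgue integral. [folklore] -/
theorem integrable_apply_rayC_I_mul {y : Fin n → SpaceTime d} (hy : y ∈ temporalCone d n)
    (F : 𝓢((Fin n → SpaceTime d), ℂ)) :
    Integrable fun x : Fin n → SpaceTime d => 𝔚 (rayC x y I) * F x :=
  integrable_mul_of_norm_le_pow (continuous_apply_rayC_I hGc hy).aestronglyMeasurable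
    (norm_apply_rayC_I_le hG hy) F

include hGc hGh hG in
/-- **Holomorphy of the smeared slices along complex temporal lines**: for `y` purely temporal,
`θ` purely temporal and `F` Schwartz, `κ ↦ ∫ 𝔚((x + iy) + κθ) F(x) dx` is holomorphic on the open
set of `κ` with `y + Im κ θ ∈ T₊` — a dominated holomorphic parameter integral, the majorant
`A (1 + ‖x‖)ᴺ |F x|` coming from the OS growth on a compact set of heights. [folklore] -/
theorem differentiableOn_integral_rayC_I_add_smul {y θ : Fin n → SpaceTime d}
    (hy : ∀ (k : Fin n) (i : Fin d), y k i.succ = 0) (hθ : ∀ (k : Fin n) (i : Fin d), θ k i.succ = 0)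
    (F : 𝓢((Fin n → SpaceTime d), ℂ)) :
    DifferentiableOn ℂ (fun κ : ℂ => ∫ x : Fin n → SpaceTime d, 𝔚 (rayC x y I + κ • cpxConfig θ) * F x)
      {κ : ℂ | ∀ k, 0 < succDiff (fun j => y j 0) k + κ.im * succDiff (fun j => θ j 0) k} := by
  set U : Set ℂ := {κ : ℂ | ∀ k, 0 < succDiff (fun j => y j 0) k + κ.im * succDiff (fun j => θ j 0) k}
    with hU
  have hUo : IsOpen U := isOpen_setOf_im_gap_pos _ _
  -- heights in the temporal cone
  have hmemT : ∀ κ ∈ U, y + κ.im • θ ∈ temporalCone d n := fun κ hκ => by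
    rw [mem_temporalCone_iff]
    refine ⟨add_smul_apply_succ_eq_zero hy hθ _, fun k => ?_⟩
    rw [succDiff_time_add_smul]; exact hκ k
  refine Literature.Analysis.Complex.differentiableOn_integral_of_dominated
    (F := fun κ x => 𝔚 (rayC x y I + κ • cpxConfig θ) * F x) (μ := volume) ?_ ?_ ?_
  · intro κ hκ
    have hc : Continuous fun x : Fin n → SpaceTime d => 𝔚 (rayC x y I + κ • cpxConfig θ) := by
      have h1 := continuous_apply_rayC_I hGc (hmemT κ hκ)
      have h2 : Continuous fun x : Fin n → SpaceTime d => x + κ.re • θ := continuous_id.add continuous_const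
      refine (h1.comp h2).congr fun x => ?_
      simp only [Function.comp_apply, rayC_I_add_smul_cpxConfig]
    exact (hc.mul F.continuous).aestronglyMeasurable
  · refine Eventually.of_forall fun x => ?_
    refine DifferentiableOn.mul ?_ (differentiableOn_const _)
    intro κ hκ
    have hmem : rayC x y I + κ • cpxConfig θ ∈ timeTube d n := rayC_I_add_smul_mem_timeTube hy hθ hκ
    -- holomorphy along the line through the point `rayC x y I + κ θ` of the time tube
    have h := differentiableOn_apply_add_smul_cpxConfig hGh hmem hθ
    have h' : DifferentiableOn ℂ (fun κ' : ℂ => 𝔚 (rayC x y I + κ' • cpxConfig θ))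
        {κ' | rayC x y I + κ' • cpxConfig θ ∈ timeTube d n} := by
      have hshift : Differentiable ℂ fun κ' : ℂ => κ' - κ := differentiable_id.sub_const κ
      have hc := h.comp hshift.differentiableOn (fun κ' (hκ' : rayC x y I + κ' • cpxConfig θ ∈ timeTube d n) => by
        show rayC x y I + κ • cpxConfig θ + (κ' - κ) • cpxConfig θ ∈ timeTube d n
        rwa [add_assoc, ← add_smul, add_sub_cancel])
      refine hc.congr fun κ' _ => ?_
      simp only [Function.comp_apply]
      rw [add_assoc, ← add_smul, add_sub_cancel]
    exact (h'.mono fun κ' hκ' => rayC_I_add_smul_mem_timeTube hy hθ hκ').differentiableAt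
      (hUo.mem_nhds hκ) |>.differentiableWithinAt
  · intro κ₀ hκ₀
    obtain ⟨R, hR, hball⟩ := Metric.isOpen_iff.1 hUo κ₀ hκ₀
    have hR2 : 0 < R / 2 := half_pos hR
    have hcl : closedBall κ₀ (R / 2) ⊆ U := (closedBall_subset_ball (half_lt_self hR)).trans hball
    -- the compact set of heights
    set K : Set (Fin n → SpaceTime d) := (fun κ : ℂ => y + κ.im • θ) '' closedBall κ₀ (R / 2) with hK
    have hKc : IsCompact K := (isCompact_closedBall κ₀ (R / 2)).image
      (continuous_const.add ((continuous_im).smul continuous_const))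
    have hKT : K ⊆ temporalCone d n := by
      rintro _ ⟨κ, hκ, rfl⟩; exact hmemT κ (hcl hκ)
    obtain ⟨A, hA0, hA⟩ := exists_norm_apply_rayC_I_le_of_isCompact hG hKc hKT
    set B : ℝ := (1 + (‖κ₀‖ + R / 2) * ‖θ‖) ^ N with hB
    refine ⟨R / 2, hR2, (ball_subset_closedBall).trans hcl,
      fun x => A * B * ((1 + ‖x‖) ^ N * ‖F x‖),
      ((integrable_one_add_norm_pow_mul_norm F N).const_mul (A * B)),
      Eventually.of_forall fun x κ hκ => ?_⟩
    have hκ' : κ ∈ closedBall κ₀ (R / 2) := ball_subset_closedBall hκ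
    have hyK : y + κ.im • θ ∈ K := ⟨κ, hκ', rfl⟩
    have h1 := hA _ hyK (x + κ.re • θ)
    rw [← rayC_I_add_smul_cpxConfig] at h1
    have hre : ‖κ.re • θ‖ ≤ (‖κ₀‖ + R / 2) * ‖θ‖ := by
      rw [norm_smul]
      refine mul_le_mul_of_nonneg_right ?_ (norm_nonneg _)
      have hk : ‖κ‖ ≤ ‖κ₀‖ + R / 2 := by
        have := mem_closedBall_iff_norm.1 hκ'
        calc ‖κ‖ = ‖κ₀ + (κ - κ₀)‖ := by rw [add_sub_cancel]
          _ ≤ ‖κ₀‖ + ‖κ - κ₀‖ := norm_add_le _ _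
          _ ≤ ‖κ₀‖ + R / 2 := by linarith
      exact (abs_re_le_norm κ).trans hk
    have hx : 1 + ‖x + κ.re • θ‖ ≤ (1 + (‖κ₀‖ + R / 2) * ‖θ‖) * (1 + ‖x‖) := by
      have h2 := norm_add_le x (κ.re • θ)
      have hM : 0 ≤ (‖κ₀‖ + R / 2) * ‖θ‖ * ‖x‖ := by positivity
      nlinarith [h2, hre, hM]
    rw [norm_mul]
    calc ‖𝔚 (rayC x y I + κ • cpxConfig θ)‖ * ‖F x‖
        ≤ A * (1 + ‖x + κ.re • θ‖) ^ N * ‖F x‖ := mul_le_mul_of_nonneg_right h1 (norm_nonneg _)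
      _ ≤ A * ((1 + (‖κ₀‖ + R / 2) * ‖θ‖) * (1 + ‖x‖)) ^ N * ‖F x‖ := by gcongr
      _ = A * B * ((1 + ‖x‖) ^ N * ‖F x‖) := by rw [hB, mul_pow]; ring

include hGc hGh hG in
/-- **The Cauchy–Riemann identity for the smeared slices** (Hörmander's `I_k' = −i I_{k+1}`,
(3.1.13)/(3.1.19) in infinitesimal form, for a function holomorphic in the times only): for
`y + s₀θ ∈ T₊` (`y`, `θ` purely temporal) and `F` Schwartz,
`d/ds|_{s₀} ∫ 𝔚(x + i(y + sθ)) F(x) dx = −i ∫ 𝔚(x + i(y + s₀θ)) (∂_θ F)(x) dx`. Proof: the smeared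
slice is the restriction to the imaginary axis of the holomorphic function
`Φ(κ) = ∫ 𝔚((x + iy) + κθ) F(x) dx`, whose restriction to horizontal lines is, by translation
invariance of Lebesgue measure, `u ↦ ∫ 𝔚(x + i(y + s₀θ)) F(x − uθ) dx`, with derivative
`−∫ 𝔚 (∂_θ F)` (`Literature.Analysis.FunctionSpaces.hasDerivAt_integral_mul_comp_sub_smul`). No
real derivative of `𝔚` is taken. [cite: HormanderALPDO1, Thm 3.1.15 proof] -/
theorem hasDerivAt_integral_rayC_I_add_smul {y θ : Fin n → SpaceTime d}
    (hy : ∀ (k : Fin n) (i : Fin d), y k i.succ = 0) (hθ : ∀ (k : Fin n) (i : Fin d), θ k i.succ = 0)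
    {s₀ : ℝ} (hs₀ : y + s₀ • θ ∈ temporalCone d n) (F : 𝓢((Fin n → SpaceTime d), ℂ)) :
    HasDerivAt (fun s : ℝ => ∫ x : Fin n → SpaceTime d, 𝔚 (rayC x (y + s • θ) I) * F x)
      (-I * ∫ x : Fin n → SpaceTime d, 𝔚 (rayC x (y + s₀ • θ) I) * (∂_{θ} F) x) s₀ := by
  set U : Set ℂ := {κ : ℂ | ∀ k, 0 < succDiff (fun j => y j 0) k + κ.im * succDiff (fun j => θ j 0) k}
    with hU
  have hUo : IsOpen U := isOpen_setOf_im_gap_pos _ _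
  set Φ : ℂ → ℂ := fun κ => ∫ x : Fin n → SpaceTime d, 𝔚 (rayC x y I + κ • cpxConfig θ) * F x with hΦ
  have hΦd : DifferentiableOn ℂ Φ U := differentiableOn_integral_rayC_I_add_smul hGc hGh hG hy hθ F
  have hs₀U : I * (s₀ : ℂ) ∈ U := by
    intro k
    have h := ((mem_temporalCone_iff _).1 hs₀).2 k
    rw [succDiff_time_add_smul] at h
    simpa using h
  have hΦ' : HasDerivAt Φ (deriv Φ (I * s₀)) (I * s₀) :=
    (hΦd.differentiableAt (hUo.mem_nhds hs₀U)).hasDerivAt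
  -- values of `Φ` on the vertical line: the smeared slices
  have hvert : ∀ s : ℝ, Φ (I * s) = ∫ x : Fin n → SpaceTime d, 𝔚 (rayC x (y + s • θ) I) * F x := by
    intro s
    simp [hΦ, rayC_I_add_smul_cpxConfig]
  -- values of `Φ` on the horizontal line through `i s₀`: translates of `F`
  have hhor : ∀ u : ℝ, Φ ((u : ℂ) + I * s₀) =
      ∫ x : Fin n → SpaceTime d, 𝔚 (rayC x (y + s₀ • θ) I) * F (x - u • θ) := by
    intro u
    have h := integral_add_right_eq_self (μ := volume)
      (fun x : Fin n → SpaceTime d => 𝔚 (rayC x (y + s₀ • θ) I) * F (x - u • θ)) (u • θ)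
    simp only [add_sub_cancel_right] at h
    rw [← h]
    simp [hΦ, rayC_I_add_smul_cpxConfig]
  -- derivative along the horizontal line
  have hline_h : HasDerivAt (fun u : ℝ => (u : ℂ) + I * s₀) 1 0 := by
    simpa using ((hasDerivAt_id ((0 : ℝ) : ℂ)).add_const (I * s₀)).comp_ofReal
  have hcomp_h : HasDerivAt (fun u : ℝ => Φ ((u : ℂ) + I * s₀)) (deriv Φ (I * s₀) * 1) 0 := by
    have hΦ0 : HasDerivAt Φ (deriv Φ (I * s₀)) ((((0 : ℝ) : ℂ)) + I * s₀) := by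
      rw [show (((0 : ℝ) : ℂ)) + I * s₀ = I * s₀ by simp]; exact hΦ'
    exact hΦ0.comp (0 : ℝ) hline_h
  have hK6 := hasDerivAt_integral_mul_comp_sub_smul (μ := volume)
    (continuous_apply_rayC_I hGc hs₀).aestronglyMeasurable (norm_apply_rayC_I_le hG hs₀) F θ
  have hderiv : deriv Φ (I * s₀) =
      -(∫ x : Fin n → SpaceTime d, 𝔚 (rayC x (y + s₀ • θ) I) * (∂_{θ} F) x) := by
    have h1 : HasDerivAt (fun u : ℝ => Φ ((u : ℂ) + I * s₀)) (deriv Φ (I * s₀)) 0 := by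
      simpa using hcomp_h
    have h2 : (fun u : ℝ => Φ ((u : ℂ) + I * s₀)) =
        fun u : ℝ => ∫ x : Fin n → SpaceTime d, 𝔚 (rayC x (y + s₀ • θ) I) * F (x - u • θ) :=
      funext hhor
    rw [h2] at h1
    exact h1.unique hK6
  -- derivative along the vertical line
  have hline_v : HasDerivAt (fun s : ℝ => I * (s : ℂ)) I s₀ := by
    simpa using ((hasDerivAt_id (s₀ : ℂ)).const_mul I).comp_ofReal
  have hcomp_v : HasDerivAt (fun s : ℝ => ∫ x : Fin n → SpaceTime d, 𝔚 (rayC x (y + s • θ) I) * F x)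
      (deriv Φ (I * s₀) * I) s₀ := by
    have h := hΦ'.comp s₀ hline_v
    have heq : (Φ ∘ fun s : ℝ => I * (s : ℂ)) =
        fun s : ℝ => ∫ x : Fin n → SpaceTime d, 𝔚 (rayC x (y + s • θ) I) * F x :=
      funext fun s => hvert s
    rwa [heq] at h
  rw [hderiv] at hcomp_v
  convert hcomp_v using 1
  ring

include hGc hGh hG in
/-- The smeared slices are continuous in the height parameter on `{y + sθ ∈ T₊}`. [folklore] -/
theorem continuousAt_integral_rayC_I_add_smul {y θ : Fin n → SpaceTime d}
    (hy : ∀ (k : Fin n) (i : Fin d), y k i.succ = 0) (hθ : ∀ (k : Fin n) (i : Fin d), θ k i.succ = 0)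
    {s₀ : ℝ} (hs₀ : y + s₀ • θ ∈ temporalCone d n) (F : 𝓢((Fin n → SpaceTime d), ℂ)) :
    ContinuousAt (fun s : ℝ => ∫ x : Fin n → SpaceTime d, 𝔚 (rayC x (y + s • θ) I) * F x) s₀ :=
  (hasDerivAt_integral_rayC_I_add_smul hGc hGh hG hy hθ hs₀ F).continuousAt

include hGc hG in
/-- **Translation invariance kills diagonal derivatives under the slice pairing**: if `𝔚` is
invariant under real diagonal translations on the time tube, then for `y ∈ T₊` and every real
`a`, `∫ 𝔚(x + iy) (∂_â F)(x) dx = 0`, `â = (a, …, a)`. [folklore] -/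
theorem integral_rayC_I_mul_lineDerivOp_diag_eq_zero
    (htr : ∀ z ∈ timeTube d n, ∀ a : SpaceTime d, 𝔚 (fun k => z k + complexifyPoint a) = 𝔚 z)
    {y : Fin n → SpaceTime d} (hy : y ∈ temporalCone d n) (a : SpaceTime d)
    (F : 𝓢((Fin n → SpaceTime d), ℂ)) :
    ∫ x : Fin n → SpaceTime d, 𝔚 (rayC x y I) * (∂_{(fun _ : Fin n => a)} F) x = 0 := by
  refine integral_mul_lineDerivOp_eq_zero_of_forall_eq (μ := volume)
    (continuous_apply_rayC_I hGc hy).aestronglyMeasurable (norm_apply_rayC_I_le hG hy) F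
    (fun _ : Fin n => a) fun u => ?_
  have h := integral_add_right_eq_self (μ := volume)
    (fun x : Fin n → SpaceTime d => 𝔚 (rayC x y I) * F (x - u • fun _ : Fin n => a))
    (u • fun _ : Fin n => a)
  simp only [add_sub_cancel_right] at h
  rw [← h]
  refine integral_congr_ae (Eventually.of_forall fun x => ?_)
  simp only
  congr 1
  have hz : rayC x y I ∈ timeTube d n := rayC_mem_timeTube x hy (by simp)
  have h1 := htr _ hz (u • a)
  convert h1 using 2
  funext k
  simp only [rayC_apply, Pi.add_apply, Pi.smul_apply, complexifyPoint_add]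
  abel

end Smeared

end Literature.MathematicalPhysics.QuantumFieldTheory
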